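import Summits.SmoothPoincare4.SmoothPoincare4.Theorems.DottedCircleRasmussenDcrGapHelperHandlebodyChartModelHandlesChart
import Summits.SmoothPoincare4.SmoothPoincare4.Theorems.DottedCircleRasmussenDcrGapHelperHandlebodyChartModelHandlesChartCover

/-!
# Helper `helper_handlebodyChart_modelHandles` (M3: handle structure of the model dotted handlebody `D_k`)
# of line `mk_friends` for crux `DcrGap` — the registered stub `helper_handlebodyChart_modelHandles_data_part1`
(item stmt-SmoothPoincare4-16128, route route-SmoothPoincare4-DottedCircleRasmussen)

**Part 1 of the data stub of M3: the explicit handle charts of `D_k = MMSW.modelHandlebody k`.**  With the base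
centre `c = (z₀, 0)`, `z₀ = -20k i` (below the row of holes `c_j = 4(j + 1)`), `a = 2/15`, the open parameter box
`W = {|p₀| < 1.01, |p₁| < 1.01, p₂² + p₃² < 6/5} ⊇ T`, and for every hole `j` the chart
`h_j(p) = (z₀ + r s (v_j/|v_j|) e(m), (r/N)(p₂ + i p₃))` — `v_j = c_j - z₀`, `N = 110(k + 1)`,
`s = √(1 - (p₂² + p₃²)/N²)`, `e(m) = (|v_j| + i m)/√(|v_j|² + m²)`, and `(r, m) = (R_j(p₀) + b(p₁) sin(π S(p₀)),
-b(p₁) cos(π S(p₀)))` the planar tube map of the profiles of `…ModelHandlesProfiles.lean` at `V = |v_j|` and the width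
`b(p₁) = (793 + 95 p₁)/500` — the charts are smooth injective immersions `W → D_k` with pairwise disjoint images,
conical about `c` (`dist = a(2 - |p₀|)` for `|p₀| ≥ 1/2`, `≥ 3a/2` for `|p₀| ≤ 1/2`), equivariant (rotation of the
`(p₂, p₃)`-plane = fibre rotation of the `w`-plane), carry smooth invariant lifts of `arg(z(h_j p) - c_l)` with the
prescribed end values (core `j` winds once about hole `j`, not about the others), and cover the explicit arches
`A_j ⊆ h_j(T)`.  All the work is in the sibling pieces `…ModelHandles{Profiles, PlanarTube, Geometry, Polar, Calculus,
Holes, Cover, Regime, Chart, CoverAux, ChartCover}.lean`; this file only chooses the profiles per hole and assembles.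

No definitions, no named facts, no `sorry`.  References: R. Kirby, *The Topology of 4-Manifolds*, LNM 1374 (1989),
Ch. I §2 [Kirby1989].
-/

-- the prescribed namespace `Summit.<P>.<Sub>.…` duplicates `SmoothPoincare4` (P = Sub)
set_option linter.dupNamespace false
set_option linter.style.longLine false
noncomputable section

open scoped Manifold ContDiff Topology ComplexConjugate
open Function Set Metric Filter
open Literature.Topology.FourManifolds Literature.Topology.FourManifolds.MMSW
open Literature.AlgebraicTopology.Homotopy.HopfFibration

namespace Summit.SmoothPoincare4.SmoothPoincare4.Theorems.DcrGap.MkFriends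

/-- **Part 1 of the data stub (explicit handle charts of `D_k`)**: with `c = (-20k i, 0)`, `a = 2/15`,
there are an open `W ⊇ T` and `k` charts `h j` with the static properties of the stub, equivariant under the
rotations of the `(p₂, p₃)`-plane, carrying explicit smooth invariant lifts of the angles about the holes with
the prescribed end values (winding `δ_{jl}`), and covering the explicit arches `A_j ⊆ h j (T)`. [folklore] -/
theorem helper_handlebodyChart_modelHandles_data_part1 : ∀ (k : ℕ), ∃ (c : EuclideanSpace ℝ (Fin 4)) (a : ℝ) (W : Set (EuclideanSpace ℝ (Fin 4))) (h : Fin k → EuclideanSpace ℝ (Fin 4) → EuclideanSpace ℝ (Fin 4)), c = Literature.AlgebraicTopology.Homotopy.HopfFibration.ofZW (Complex.mk 0 (-(20 * (k : ℝ)))) 0 ∧ a = 2 / 15 ∧ (0 < a ∧ Metric.closedBall c (3 * a / 2) ⊆ Literature.Topology.FourManifolds.MMSW.modelHandlebody k ∧ IsOpen W ∧ {p : EuclideanSpace ℝ (Fin 4) | |p 0| ≤ 1 ∧ (p 1) ^ 2 + (p 2) ^ 2 + (p 3) ^ 2 ≤ 1} ⊆ W ∧ (∀ j, ContDiffOn ℝ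 ((⊤ : ℕ∞) : WithTop ℕ∞) (h j) W ∧ Set.InjOn (h j) W ∧ (∀ p ∈ W, Function.Injective (fderiv ℝ (h j) p)) ∧ Set.MapsTo (h j) W (Literature.Topology.FourManifolds.MMSW.modelHandlebody k)) ∧ (∀ j l, j ≠ l → ∀ p ∈ W, ∀ q ∈ W, h j p ≠ h l q) ∧ (∀ j, ∀ p ∈ W, 1 / 2 ≤ |p 0| → dist (h j p) c = a * (2 - |p 0|)) ∧ (∀ j, ∀ p ∈ W, |p 0| ≤ 1 / 2 → 3 * a / 2 ≤ dist (h j p) c)) ∧ (∀ j (β : ℝ), ∀ p ∈ W, h j (!₂[p 0, p 1, Real.cos β * p 2 - Real.sin β * p 3, Real.sin β * p 2 + Real.cos β * p 3]) = Literature.Topology.FourManifolds.MMSW.fibreRot (fun _ => Complex.exp ((β : ℂ) * Complex.I)) (h j p)) ∧ (∀ j l, ∃ Λ : EuclideanSpace ℝ (Fin 4) → ℝ, ContDiffOn ℝ ((⊤ : ℕ∞) : WithTop ℕ∞) Λ W ∧ (∀ p ∈ W, Complex.exp ((Λ p : ℂ) * Complex.I) = (Literature.AlgebraicTopology.Homotopy.HopfFibration.zC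 (h j p) - Literature.Topology.FourManifolds.MMSW.holeCentre k l) / (((‖Literature.AlgebraicTopology.Homotopy.HopfFibration.zC (h j p) - Literature.Topology.FourManifolds.MMSW.holeCentre k l‖ : ℝ)) : ℂ)) ∧ (∀ (β : ℝ), ∀ p ∈ W, !₂[p 0, p 1, Real.cos β * p 2 - Real.sin β * p 3, Real.sin β * p 2 + Real.cos β * p 3] ∈ W → Λ (!₂[p 0, p 1, Real.cos β * p 2 - Real.sin β * p 3, Real.sin β * p 2 + Real.cos β * p 3]) = Λ p) ∧ (∀ p ∈ W, 1 / 2 ≤ |p 0| → Λ p = Complex.arg ((Literature.AlgebraicTopology.Homotopy.HopfFibration.zC (h j p) - Literature.Topology.FourManifolds.MMSW.holeCentre k l) * (starRingEnd ℂ) (Literature.AlgebraicTopology.Homotopy.HopfFibration.zC c - Literature.Topology.FourManifolds.MMSW.holeCentre k l)) + Complex.arg (Literature.AlgebraicTopology.Homotopy.HopfFibration.zC c - Literature.Topology.FourManifolds.MMSW.holeCentre k l) + (if j = l ∧ 0 < p 0 then 2 * Real.pi else 0))) ∧ (∀ j (y : EuclideanSpace ℝ (Fin 4)) (q v : ℂ),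 q = Literature.AlgebraicTopology.Homotopy.HopfFibration.zC y - Complex.mk 0 (-(20 * (k : ℝ))) → v = Literature.Topology.FourManifolds.MMSW.holeCentre k j - Complex.mk 0 (-(20 * (k : ℝ))) → ‖Literature.AlgebraicTopology.Homotopy.HopfFibration.wC y‖ ≤ 1 / (2000 * ((k : ℝ) + 1)) ∧ ((8 / 5 ≤ ‖q - v‖ ∧ ‖q - v‖ ≤ 41 / 25 ∧ -(7 / 10) * ‖v‖ ≤ ((q - v) * (starRingEnd ℂ) v).re) ∨ (2 / 15 ≤ ‖q‖ ∧ ‖q‖ ≤ ‖v‖ + 1 / 2 ∧ 0 < (q * (starRingEnd ℂ) v).re ∧ 8 / 5 * ‖q‖ ≤ |(q * (starRingEnd ℂ) v).im| ∧ |(q * (starRingEnd ℂ) v).im| ≤ 41 / 25 * ‖q‖)) → ∃ p ∈ {p : EuclideanSpace ℝ (Fin 4) | |p 0| ≤ 1 ∧ (p 1) ^ 2 + (p 2) ^ 2 + (p 3) ^ 2 ≤ 1}, h j p = y) := by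
  intro k
  -- the profiles of each hole, at `V = |v_j|`
  have hdir : ∀ j : Fin k, 20 ≤ ‖holeCentre k j - Complex.mk 0 (-(20 * (k : ℝ)))‖ := fun j =>
    (ModelHandles.holeDir_props j (v := holeCentre k j - Complex.mk 0 (-(20 * (k : ℝ)))) rfl).2.2.2.2.2.1
  have hprof := fun j : Fin k =>
    ModelHandles.exists_tube_profiles ‖holeCentre k j - Complex.mk 0 (-(20 * (k : ℝ)))‖ (by linarith [hdir j])
  choose R S hP using hprof
  -- the charts
  set b : ℝ → ℝ := fun p => (793 + 95 * p) / 500 with hb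
  set N : ℝ := 110 * ((k : ℝ) + 1) with hN
  set e : Fin k → ℝ → ℂ := fun j m => (((‖holeCentre k j - Complex.mk 0 (-(20 * (k : ℝ)))‖ : ℝ) : ℂ) + (m : ℂ) * Complex.I) *
    (((Real.sqrt (‖holeCentre k j - Complex.mk 0 (-(20 * (k : ℝ)))‖ ^ 2 + m ^ 2))⁻¹ : ℝ) : ℂ) with he
  set fr : Fin k → ℝ → ℝ → ℝ := fun j t p => R j t + b p * Real.sin (Real.pi * S j t) with hfr
  set fm : Fin k → ℝ → ℝ → ℝ := fun j t p => -(b p) * Real.cos (Real.pi * S j t) with hfm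
  set h : Fin k → EuclideanSpace ℝ (Fin 4) → EuclideanSpace ℝ (Fin 4) := fun j p =>
    ofZW (Complex.mk 0 (-(20 * (k : ℝ))) + ((fr j (p 0) (p 1) * Real.sqrt (1 - ((p 2) ^ 2 + (p 3) ^ 2) / N ^ 2) : ℝ) : ℂ) *
      ((holeCentre k j - Complex.mk 0 (-(20 * (k : ℝ)))) / ((‖holeCentre k j - Complex.mk 0 (-(20 * (k : ℝ)))‖ : ℝ) : ℂ)) *
      e j (fm j (p 0) (p 1))) (((fr j (p 0) (p 1) / N : ℝ) : ℂ) * ((p 2 : ℂ) + (p 3 : ℂ) * Complex.I)) with hh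
  set W : Set (EuclideanSpace ℝ (Fin 4)) :=
    {p : EuclideanSpace ℝ (Fin 4) | |p 0| < 101 / 100 ∧ |p 1| < 101 / 100 ∧ (p 2) ^ 2 + (p 3) ^ 2 < 6 / 5} with hW
  have hz : ∀ j p, zC (h j p) = Complex.mk 0 (-(20 * (k : ℝ))) +
      ((fr j (p 0) (p 1) * Real.sqrt (1 - ((p 2) ^ 2 + (p 3) ^ 2) / N ^ 2) : ℝ) : ℂ) *
      ((holeCentre k j - Complex.mk 0 (-(20 * (k : ℝ)))) / ((‖holeCentre k j - Complex.mk 0 (-(20 * (k : ℝ)))‖ : ℝ) : ℂ)) *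
      e j (fm j (p 0) (p 1)) := fun j p => zC_ofZW _ _
  have hw : ∀ j p, wC (h j p) = ((fr j (p 0) (p 1) / N : ℝ) : ℂ) * ((p 2 : ℂ) + (p 3 : ℂ) * Complex.I) :=
    fun j p => wC_ofZW _ _
  have he' : ∀ j m, e j m = (((‖holeCentre k j - Complex.mk 0 (-(20 * (k : ℝ)))‖ : ℝ) : ℂ) + (m : ℂ) * Complex.I) *
      (((Real.sqrt (‖holeCentre k j - Complex.mk 0 (-(20 * (k : ℝ)))‖ ^ 2 + m ^ 2))⁻¹ : ℝ) : ℂ) := fun j m => rfl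
  have hfr' : ∀ j, fr j = fun t p => R j t + b p * Real.sin (Real.pi * S j t) := fun j => rfl
  have hfm' : ∀ j, fm j = fun t p => -(b p) * Real.cos (Real.pi * S j t) := fun j => rfl
  obtain ⟨hWo, hTW⟩ := ModelHandles.box_props hW
  -- the per-chart packages
  have hstat := fun j : Fin k => by
    obtain ⟨hRs, hSs, hReven, hSsymm, hRout, hRbend, hRbounds, hRmono, hS0, hS1, hSmono, hS01, hjac⟩ := hP j
    exact ModelHandles.chart_static rfl hRs hSs hReven hSsymm hRout hRbend hRbounds hRmono hS0 hS1 hSmono hS01 hjac hb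
      hN (he' j) (hfr' j) (hfm' j) (hz j) (hw j) hW
  have hmaps := fun j : Fin k => by
    obtain ⟨-, -, hReven, -, hRout, hRbend, hRbounds, hRmono, hS0, hS1, -, hS01, -⟩ := hP j
    exact ModelHandles.chart_mapsTo rfl hReven hRout hRbend hRbounds hRmono hS0 hS1 hS01 hb hN (he' j) (hfr' j) (hfm' j)
      (hz j) (hw j) hW
  refine ⟨ofZW (Complex.mk 0 (-(20 * (k : ℝ)))) 0, 2 / 15, W, h, rfl, rfl, ⟨by norm_num, ?_, hWo, hTW,
    fun j => ⟨(hstat j).1, (hstat j).2.1, (hstat j).2.2.1, hmaps j⟩, fun j l hjl => ?_, fun j p hp hh => (hstat j).2.2.2.2.1 p hp hh,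
    fun j p hp hh => (hstat j).2.2.2.2.2.1 p hp hh⟩, fun j β p _ => (hstat j).2.2.2.2.2.2 β p, fun j l => ?_, fun j y q v hq hv hy => ?_⟩
  · -- the base ball
    rw [show (3 : ℝ) * (2 / 15) / 2 = 1 / 5 by norm_num]
    exact ModelHandles.baseBall_subset k
  · -- disjointness
    obtain ⟨-, -, hReven, -, hRout, hRbend, hRbounds, hRmono, hS0, hS1, -, hS01, -⟩ := hP j
    obtain ⟨-, -, hReven₂, -, hRout₂, hRbend₂, hRbounds₂, hRmono₂, hS0₂, hS1₂, -, hS01₂, -⟩ := hP l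
    exact ModelHandles.charts_disjoint hjl rfl rfl hReven hRout hRbend hRbounds hRmono hS0 hS1 hS01 hReven₂ hRout₂ hRbend₂
      hRbounds₂ hRmono₂ hS0₂ hS1₂ hS01₂ hb hN (he' j) (he' l) (hfr' j) (hfm' j) (hfr' l) (hfm' l) (hz j) (hz l) hW
  · -- the lifts
    obtain ⟨-, -, hReven, -, hRout, hRbend, hRbounds, hRmono, hS0, hS1, -, hS01, -⟩ := hP j
    have hZs : ContDiffOn ℝ ∞ (fun p => zC (h j p)) W := contDiff_zC.comp_contDiffOn (hstat j).1
    obtain ⟨Λ, h1, h2, h3, h4⟩ := ModelHandles.chart_lifts rfl hReven hRout hRbend hRbounds hRmono hS0 hS1 hS01 hb hN (he' j)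
      (hfr' j) (hfm' j) (hz j) hW hZs l
    refine ⟨Λ, h1, h2, h3, fun p hp hh => ?_⟩
    rw [zC_ofZW]; exact h4 p hp hh
  · -- the cover
    obtain ⟨-, -, hReven, hSsymm, hRout, hRbend, hRbounds, hRmono, hS0, hS1, -, hS01, -⟩ := hP j
    have hopen : ∀ p ∈ W, ∀ s ∈ 𝓝 p, h j '' s ∈ 𝓝 (h j p) := fun p hp s hs =>
      ModelHandles.image_mem_nhds_of_injective_fderiv (((hstat j).1.contDiffAt (hWo.mem_nhds hp))) (by simp)
        ((hstat j).2.2.1 p hp) hs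
    exact ModelHandles.chart_cover rfl hReven hSsymm hRout hRbend hRbounds hRmono hS0 hS1 hS01 hb hN (he' j) (hfr' j) (hfm' j)
      (hz j) (hw j) hW (hstat j).1.continuousOn hopen y q v hq hv hy

end Summit.SmoothPoincare4.SmoothPoincare4.Theorems.DcrGap.MkFriends

end
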